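import Literature.AlgebraicGeometry.ModuliOfAbelianVarieties.SiegelAdmissibleOfPairingRead
import Literature.AlgebraicGeometry.Motives.AbelianVarietyWeilPairingNormalFormTransport
import HarnessLib

/-!
# Admissibility of a principal representative from a marking framed by a symplectic basis of `c₁(Θ^an)`
# ([Milne 2005] Thm. 6.11; [Deligne 1971] 4.12 (b); [Lange 2023] §3.1)

Topic `AlgebraicGeometry/ModuliOfAbelianVarieties`; namespace `Literature.AlgebraicGeometry.ModuliOfAbelianVarieties`.
KERNEL ONLY: theorems; no definition, no named fact, no instance, no `sorry`.  Cell `hodgecm-mathlib`, rung-0 U-DAG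
brick **B4 (d)**, third assembly layer (consumer glue, B-plan1 R67 (3)): over ★ `exists_isAdmissibleAt_of_pairingRead`
(`SiegelAdmissibleOfPairingRead`) the pairing readings `hpair` are DISCHARGED by ★
`AbelianVariety.weilPairingLevel_eq_exp_pow_typeFormMod_of_mapMatrix` (`AbelianVarietyWeilPairingNormalFormTransport`):
for a marking whose torsion parametrisation is the ORIGINAL uniformisation `φ : ℝ^ι/ℤ^ι → A(ℂ)` read through an integer
frame `T : ℤ^{2g} → ℤ^ι` that is symplectic of type `δ` for `E = c₁([𝒪(Θ)^an])` (`ᵗT · intGram Φ E · T = typeForm δ`),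
the Weil pairing of `Θ` on points read at `x̃/M`, `ỹ/M` is `e(2πi/M) ^ E_δ(x, y)`.  No Appell–Humbert or Picard transport is
needed: `(Φ, φ, p)` stay those of the uniformisation.  The remaining input of the (U3) existence clause is thus the
NORMAL-FORM MARKING of R67 (3) (`exists_siegelAdelicMarking_normalForm`: `Z ∈ 𝔥_g`, the frame `T` of a Frobenius basis
of `E`, and a marking by `[J(Z), 1]` with `u(v) = φ (T [ṽ])`), fed by POSITIVITY (R67 (2)) and the TYPE MATCH (R67 (1)).
HC_CM is proved only modulo the 7 printed citations until rung 0 closes.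

* **`exists_isAdmissibleAt_of_normalFormFrame`** — the statement above, for any marking torus chart `Ψ` on `ℝ^{2g}`.

## References
* [Milne2005ShimuraVarieties] J. S. Milne, *Introduction to Shimura varieties* (2005), §6 Thm. 6.11 pp. 74–75, §12 (63).
* [Deligne1971TravauxShimura] P. Deligne, *Travaux de Shimura* (1971), 4.12 (b) pp. 148–149, Exemple 4.16 p. 150.
* [Lange2023AbelianVarietiesComplex] H. Lange, *Abelian Varieties over the Complex Numbers* (2023), §3.1 (type of a
  polarisation, symplectic basis), §1.5.1 (Gram matrix on the lattice).
-/

set_option autoImplicit false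

noncomputable section

open Matrix NumberField IsDedekindDomain CategoryTheory AlgebraicGeometry

namespace Literature.AlgebraicGeometry.ModuliOfAbelianVarieties

open Literature.AlgebraicGeometry.Motives (AbelianVariety AlgPoints CartierDivisor specOver ComplexPoints)
open Literature.AlgebraicGeometry.AbelianSchemes (AbelianSchemeOver PolarizedAbelianSchemeWithLevel)
open Literature.Geometry.Kaehler (ComplexTorus)
open Literature.Geometry.Kaehler.ComplexTorus (AHData proj mapMatrix intGram picClass)
open Literature.NumberTheory.Transcendental (IsAnalytification)
open Literature.AlgebraicGeometry.HodgeTheory (cartierDivisorLineBundle)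
open Literature.NumberTheory.Adeles
open Literature.NumberTheory.Automorphic (siegelUpperHalfSpace)
open SiegelModuli

variable {g : ℕ} {δ : Fin g → ℕ}

/-- **ADMISSIBILITY FROM A MARKING FRAMED BY A SYMPLECTIC BASIS OF `c₁(Θ^an)`** ((U3)∃ of ★
`siegelModuli_complexUniformisation`; [Milne2005ShimuraVarieties] Thm. 6.11; [Deligne1971TravauxShimura] 4.12 (b)).
DATA: `δ` a polarisation type, `0 < g`, `N ≠ 0`; `P′` a polarised abelian scheme of type `δ` with level-`N` structure over
`Spec ℂ`, `A` its fibre; an ample `Θ` with `λ̄ = Λ(𝒪(Θ))` at the point; a uniformisation `φ : ℝ^ι/ℤ^ι → A(ℂ)` (chart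
`Φ`, analytification, additive) with an Appell–Humbert datum `p` of `[𝒪(Θ)^an]`; an integer frame `T : ℤ^{2g} → ℤ^ι`
symplectic of type `δ` for `E = c₁([𝒪(Θ)^an])` (`ᵗT · intGram Φ E · T = typeForm δ` — [Lange2023AbelianVarietiesComplex]
§3.1: the columns of `T` are a symplectic basis); and a marking `m₀` of `A` by `[J(Z₀), a₀]`, `a₀ ∈ K_δ(1)`, whose torsion
parametrisation is `u₀(v) = φ (T [ṽ]_Ψ)` (`T` acting through ★ `mapMatrix Ψ Φ T` from any chart `Ψ` on `ℝ^{2g}` — e.g.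
★ `exists_siegelAdelicMarking_of_addEquiv` with `h = mapMatrix (siegelPeriodEquiv hδ hZ₀) Φ T`).  CONCLUSION: the (U3)
data `(c, u, r)` (★ `exists_principalRep` clauses verbatim) and `Z ∈ 𝔥_g` with `IsAdmissibleAt hδ r Z hZ P′`.  Proof: a
point read at `x̃/M` through `b = 1` is `u₀(x̃/M) = φ (T [x̃/M]_Ψ)`, so ★ `weilPairingLevel_eq_exp_pow_typeFormMod_of_mapMatrix`
is `hpair` with `ζ_M = e(2πi/M)`; then ★ `exists_isAdmissibleAt_of_pairingRead`.
[cite: Milne2005ShimuraVarieties, §6 Thm. 6.11 pp. 74–75 and §12 (63) p. 116] [cite: Deligne1971TravauxShimura, 4.12 (b) pp. 148–149 and 4.16 p. 150]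
[cite: Lange2023AbelianVarietiesComplex, §3.1 and §1.5.1] -/
theorem exists_isAdmissibleAt_of_normalFormFrame (hδ : IsPolarizationType δ) (hg : 0 < g) {N : ℕ} (hN : N ≠ 0)
    (P' : PolarizedAbelianSchemeWithLevel g N δ (specOver ℚ ℂ).left)
    (Θ : CartierDivisor (P'.A.fibre (𝟙 (Spec (CommRingCat.of ℂ)))).toAbelianVariety.X.left) (hΘ : Θ.IsAmple)
    (hlam : P'.A.IsLambdaOfAt (𝟙 (Spec (CommRingCat.of ℂ))) P'.D P'.pol.lam Θ)
    {ι : Type} [Fintype ι] [DecidableEq ι]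
    {Φ : (ι → ℝ) ≃L[ℝ] (Fin (P'.A.fibre (𝟙 (Spec (CommRingCat.of ℂ)))).toAbelianVariety.dim → ℂ)}
    {φ : ComplexTorus Φ → ComplexPoints (P'.A.fibre (𝟙 (Spec (CommRingCat.of ℂ)))).toAbelianVariety.X}
    (hφ : IsAnalytification (Fin (P'.A.fibre (𝟙 (Spec (CommRingCat.of ℂ)))).toAbelianVariety.dim → ℂ)
      (P'.A.fibre (𝟙 (Spec (CommRingCat.of ℂ)))).toAbelianVariety.X
      (P'.A.fibre (𝟙 (Spec (CommRingCat.of ℂ)))).toAbelianVariety.dim φ)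
    (hadd : ∀ x y, φ (x + y) = φ x * φ y)
    (p : AHData Φ) (hp : AHData.toPic p = picClass (cartierDivisorLineBundle hφ Θ))
    {E' : Type} [NormedAddCommGroup E'] [NormedSpace ℂ E'] (Ψ : (Fin g ⊕ Fin g → ℝ) ≃L[ℝ] E')
    (T : Matrix ι (Fin g ⊕ Fin g) ℤ) (hT : Tᵀ * intGram Φ p.form * T = typeForm δ)
    (Z₀ : siegelUpperHalfSpace g) {a₀ : gspFinAdelic δ} (ha₀ : a₀ ∈ principalLevelSubgroup δ 1)
    (m₀ : SiegelAdelicMarking ⟨jOfSiegel δ Z₀, jOfSiegel_coe_mem_C0pm hδ.1 Z₀⟩ a₀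
      (P'.A.fibre (𝟙 (Spec (CommRingCat.of ℂ)))).toAbelianVariety)
    (hr : ∀ v : Fin g ⊕ Fin g → ℚ, m₀.r v = φ (mapMatrix Ψ Φ T (proj Ψ fun i => ((v i : ℚ) : ℝ)))) :
    ∃ (c : (ZMod N)ˣ) (u : finAdeleQˣ) (r : gspFinAdelic δ),
      (∀ v, Valued.v ((u : finAdeleQ) v) = 1) ∧
      (u : finAdeleQ) - ((c : ZMod N).val : ℕ) ∈ levelIdeal N ∧
      r ∈ principalLevelSubgroup δ 1 ∧
      IsMultiplier (typeFormOver δ finAdeleQ) (r : GL (Fin g ⊕ Fin g) finAdeleQ) u ∧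
      ((r : GL (Fin g ⊕ Fin g) finAdeleQ) : Matrix (Fin g ⊕ Fin g) (Fin g ⊕ Fin g) finAdeleQ) =
        Matrix.fromBlocks 1 0 0 ((u : finAdeleQ) • (1 : Matrix (Fin g) (Fin g) finAdeleQ)) ∧
      ∃ (Z : Matrix (Fin g) (Fin g) ℂ) (hZ : Z ∈ siegelUpperHalfSpace g), IsAdmissibleAt hδ r Z hZ P' := by
  -- the roots of unity `ζ_M = e(2πi/M)`
  set ζ : ℕ → ℂ := fun M => Complex.exp (2 * Real.pi * Complex.I / M) with hζ_def
  have hζ : ∀ ⦃M : ℕ⦄, N ∣ M → M ≠ 0 → IsPrimitiveRoot (ζ M) M := fun M _ hM =>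
    Complex.isPrimitiveRoot_exp M hM
  have hζ_pow : ∀ ⦃M : ℕ⦄ (k : ℕ), N ∣ M → M ≠ 0 → k ≠ 0 → ζ (k * M) ^ k = ζ M := by
    intro M k _ hM hk
    have hMc : (M : ℂ) ≠ 0 := Nat.cast_ne_zero.2 hM
    have hkc : (k : ℂ) ≠ 0 := Nat.cast_ne_zero.2 hk
    simp only [hζ_def]
    rw [← Complex.exp_nat_mul]
    congr 1
    push_cast
    field_simp
  -- reading through `b = 1` is the identity on classes
  have hone : ∀ v : Fin g ⊕ Fin g → ℚ,
      AdelicCongr (((1 : gspFinAdelic δ)⁻¹ : gspFinAdelic δ) : GL (Fin g ⊕ Fin g) finAdeleQ) 1 v v := by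
    intro v i
    rw [inv_one, OneMemClass.coe_one, Pi.sub_apply, sub_self]
    exact zero_mem _
  -- the rational lattice coordinates `x̃/M` in the transport leaf's spelling
  have hvec : ∀ {M : ℕ} (x : Fin g ⊕ Fin g → ZMod M),
      (fun i => ((((fun j => ((x j).val : ℚ) / M) i : ℚ) : ℝ))) = (M : ℝ)⁻¹ • fun i => ((x i).val : ℝ) := by
    intro M x
    funext i
    simp only [Pi.smul_apply, smul_eq_mul, Rat.cast_div, Rat.cast_natCast]
    ring
  have hpair : ∀ ⦃M : ℕ⦄, N ∣ M → ∀ (hMΩ : (M : ℂ) ≠ 0) (x y : Fin g ⊕ Fin g → ZMod M)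
      (P Q : (P'.A.fibre (𝟙 (Spec (CommRingCat.of ℂ)))).toAbelianVariety.torsionPoints ℂ (M : ℤ)),
      (∀ v, AdelicCongr (((1 : gspFinAdelic δ)⁻¹ : gspFinAdelic δ) : GL (Fin g ⊕ Fin g) finAdeleQ) 1 v
          (fun i => ((x i).val : ℚ) / M) →
          (P : (P'.A.fibre (𝟙 (Spec (CommRingCat.of ℂ)))).toAbelianVariety.Points ℂ) = m₀.r v) →
      (∀ w, AdelicCongr (((1 : gspFinAdelic δ)⁻¹ : gspFinAdelic δ) : GL (Fin g ⊕ Fin g) finAdeleQ) 1 w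
          (fun i => ((y i).val : ℚ) / M) →
          (Q : (P'.A.fibre (𝟙 (Spec (CommRingCat.of ℂ)))).toAbelianVariety.Points ℂ) = m₀.r w) →
      haveI := AbelianVariety.isDominant_toSchemeHom_zsmul_of_ne_zero
        (P'.A.fibre (𝟙 (Spec (CommRingCat.of ℂ)))).toAbelianVariety hMΩ
      (P'.A.fibre (𝟙 (Spec (CommRingCat.of ℂ)))).toAbelianVariety.weilPairingLevel Θ P Q =
        ζ M ^ (AbelianSchemeOver.typeFormMod δ M x y).val := by
    intro M hNM hMΩ x y P Q hP hQ
    have hM : M ≠ 0 := by rintro rfl; exact hMΩ Nat.cast_zero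
    haveI := AbelianVariety.isDominant_toSchemeHom_zsmul_of_ne_zero
      (P'.A.fibre (𝟙 (Spec (CommRingCat.of ℂ)))).toAbelianVariety hMΩ
    have hPx := hP _ (hone _)
    have hQy := hQ _ (hone _)
    rw [hr, hvec] at hPx
    rw [hr, hvec] at hQy
    exact AbelianVariety.weilPairingLevel_eq_exp_pow_typeFormMod_of_mapMatrix hφ hadd hM Θ p hp T hT x y P Q
      hPx hQy
  exact exists_isAdmissibleAt_of_pairingRead hδ hg hN P' Θ hΘ hlam Z₀ ha₀ m₀ (one_mem _) ζ hζ hζ_pow hpair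

end Literature.AlgebraicGeometry.ModuliOfAbelianVarieties

end
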